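import Mathlib
import HarnessLib
import HarnessLib.Audit
import Summits.QuantumFields.Statement
import Literature.Barriers.QuantumFields.ToronPlaneAnticorrelation
import HarnessLib.Audit.Status.Attr

/-!
Route: ToronCumulantSign

# Route ToronCumulantSign — Griffiths II fails for SU(N) plaquette energies — the one-site first
β-cumulant is −4/(N³(N²−1)) (discharges the barrier fact ToronPlaneAnticorrelation) (LINE)

X («it suffices to show X»), a LINE onto the EXISTING barrier-ledger named fact
`Literature.Barriers.QuantumFields.ToronPlaneAnticorrelation` (∀ N ≥ 2 ∃ torus (ℤ/L)⁴ and β > 0 with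
`complementaryPlaneCov N L β < 0`: the SU(N) Wilson plaquette energies of the two plaquettes through
the origin in the complementary
planes (01), (23) are NEGATIVELY correlated), which the tree carries UNDISCHARGED («witness (W1)
rests on an elementary Haar-moment
computation not yet formalised», scope_caveats (a)) as the hypothesis of the blocking theorem
`ToronPlaneAnticorrelation.exists_not_forall_admits` (no product-closed local association criterion
— FKG/Holley, Ginibre systems,
preservation of positivity — can certify Griffiths II for non-abelian plaquette energies; the
barrier that killed items
stmt-QuantumFields-9712 `PlaquetteCovarianceNonneg` and -9756 `DualPositiveAssociation`). X = X1 ∧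
X2 (∧ the support X0) reaches the fact
through the tree reduction `toronPlaneAnticorrelation_of_oneSite` (one-site witnesses for every N ≥
2 ⇒ the fact): X1 = `CommutatorSkewMoment`
(rank 2, deciding): the signed two-matrix quartic Haar moment κ_N := ∫∫ (|tr X|² − 1)(|tr Y|² − 1)
Re tr(XYX⁻¹Y⁻¹) dX dY = −1/(N(N²−1)) on
SU(N), N ≥ 2; X2 = `OneSiteCovDerivative` (rank 3): on the one-site (Eguchi–Kawai) torus L = 1 the
covariance β ↦ Cov_β(Re tr U_(0;01),
Re tr U_(0;23)) has derivative (4/N²)·κ_N at β = 0; X0 = `OneSiteCovAtZero` (support): it vanishes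
at β = 0. Then f(0) = 0, f′(0) =
−4/(N³(N²−1)) < 0 ⇒ f(β) < 0 for some small β > 0 ⇒ the fact. No idea card is realised (ideas: []);
no summit, leaf, NT, UV or IR statement
is proved by this line — it bears on the BARRIER ledger (LADDER-YM §1c row
`Literature/Barriers/QuantumFields/*`): it turns a named,
numerically witnessed obstruction into a theorem.
Lean: `Summit.QuantumFields.YangMills.Theses.ToronCumulantSign.CommutatorSkewMoment ∧
Summit.QuantumFields.YangMills.Theses.ToronCumulantSign.OneSiteCovDerivative ∧
Summit.QuantumFields.YangMills.Theses.ToronCumulantSign.OneSiteCovAtZero`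

## Assembly
Pure logic plus one line of real analysis, certified in glue.lean: `closes : CommutatorSkewMoment →
OneSiteCovDerivative → OneSiteCovAtZero →
Literature.Barriers.QuantumFields.ToronPlaneAnticorrelation` applies the tree reduction
`toronPlaneAnticorrelation_of_oneSite`; for each
N ≥ 2 it rewrites the derivative of crux 3 with the value of crux 2, checks 4/N² · (−1/(N(N²−1))) <
0 (nlinarith/positivity), and from
f(0) = 0 (support), HasDerivAt f c 0, c < 0 produces β > 0 with f(β) < 0
(`HasDerivAt.tendsto_slope_zero_right`, eventually in 𝓝[>] 0).
The Assembly item records the same implication as a statement (schema: one assembly item at open);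
the deciding theorem is `closes`.

Rationale: WHY THIS LINE. The seat's technique card is «positivity / convexity»; its censuses g3–g6 found every
POSITIVE correlation-inequality engine for
non-abelian plaquette energies either refuted (negatives 9712/9756, measured) or confined to abelian
factors (Ginibre, GKS II,
Messager–Miracle-Solé–Pfister, Fröhlich centre domination — all proved in the tree), so the card's
remaining certified content is the
NEGATIVE side: prove that Griffiths' second inequality fails for SU(N). The mechanism is the first
β-cumulant of the one-site Wilson
measure μ_β = π.tilted(−β S_W) (tree `wilsonMeasure_eq_tilted_pi`, arXiv:1803.01950 §2–3): d/dβ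
Cov_β(F, G)|₀ = Σ_p E_π[F̃ G̃ P̃_p] over
the six one-site plaquettes; the in-plane terms vanish by independence and each of the four mixed
planes reduces, after the Schur
integration ∫ Re tr(g h g⁻¹ h⁻¹) dh = |tr g|²/N (tree GaugeBoot `integral_re_trace_conj_mul`
pattern), to κ_N/N², and κ_N is evaluated by
invariant integration imported from free probability / invariant theory (degree-two unitary
Weingarten calculus, CollinsSniady2006
Cor. 2.4; Creutz, Quarks Gluons and Lattices, Ch. 8 «Group integration», doi:10.1017/9781009290395):
the conjugation-equivariant map
Φ(A) = E[|tr Y|² Y A Y*] = A/(N²−1) + ((N²−2)/((N−1)N(N+1))) tr(A)·1 (two (2,2) moments E|Y₀₀|⁴ =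
2/(N(N+1)), E|Y₀₀|²|Y₁₁|² = 1/(N²−1),
both ALREADY in the tree:
`Summit.Ventures.YMGap.HaarFourthMomentSUN.integral_normSq_mul_normSq_diag`,
`…SUNTrace.integral_normSq_trace_sq_suN`,
`RobustBall.HaarSecondMoments.integral_normSq_trace`; SU(2): `Thresholds/HaarFourthMoment.lean`,
`FlowData.su2_integral_re_trace_commutator_eq`)
gives E_Y[(|tr Y|²−1) tr(XYX*Y*)] = (N² − |tr X|²)/(N(N²−1)) and then κ_N = (N²·1 − 2 − N² +
1)/(N(N²−1)) = −1/(N(N²−1)). The barrier file's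
"no Weingarten calculus in the tree" is stale since the YMGap venture's quartic Haar files landed;
this line is the first to point them
at the barrier. No listed route, dead route or card targets `ToronPlaneAnticorrelation` or mentions
`complementaryPlaneCov` (lean search;
Theses grep: only a docstring of SZZPoincareApplications / ZnCentreDominatedWilsonLoops), and the
negatives index entries 9712/9756 are
on the opposite (positive) side, so nothing is restated.

RANKED CRUXES. #2 CommutatorSkewMoment (crux) — For every N ≥ 2, with dX, dY the Haar probability
measures of SU(N): ∫∫ (|tr X|² − 1)(|tr Y|² − 1) Re tr(X Y X⁻¹ Y⁻¹) dX dY = −1/(N(N²−1)) (N = 2: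
−1/6; N = 3: −1/24). [difficulty: M] (why it might fail: Only the constant can be wrong (a slip in α
= 1/(N²−1), β′ = (N²−2)/((N−1)N(N+1)) or an SU(2)-specific invariant); the SIGN is checked at N = 2
by hand (S³ moments, −1/6), by the barrier's MC kit j022105 (−0.1664(17)) and at N = 2…5 by the
seat's Haar MC kit j306420.) [CollinsSniady2006, doi:10.1017/9781009290395,
Literature.Barriers.QuantumFields.ToronPlaneAnticorrelation]
#3 OneSiteCovDerivative (crux) — For every N ≥ 2, on the one-site torus (ℤ/1)⁴ the
complementary-plane covariance β ↦ Literature.Barriers.QuantumFields.complementaryPlaneCov N 1 β =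
Cov_{N,1,β}(Re tr U_(0;01), Re tr U_(0;23)) is differentiable at β = 0 with derivative (4/N²)·κ_N,
κ_N the commutator skew moment of crux 2 (first β-cumulant of the Gibbs-tilted product Haar measure:
the two in-plane plaquettes contribute 0, the four mixed planes (02), (03), (12), (13) contribute
κ_N/N² each after the inner Schur integrations ∫ Re tr(g h g⁻¹ h⁻¹) dh = |tr g|²/N). [difficulty: L]
(why it might fail: Bookkeeping: the two in-plane terms must vanish exactly (independence at β = 0)
and each of the four mixed planes must give κ_N/N²; an orientation slip in plaquetteHolonomy_oneSite
would change the factor 4/N² (not the sign: Re tr of a commutator is orientation-blind).)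
[arXiv:1803.01950, Wilson1974, CollinsSniady2006]
#9 OneSiteCovAtZero (support) — At β = 0 the one-site Wilson measure is product Haar on the four
links and the two plaquette energies Re tr U_(0;01) (links 0, 1) and Re tr U_(0;23) (links 2, 3) are
independent, so Literature.Barriers.QuantumFields.complementaryPlaneCov N 1 0 = 0 for every N ≥ 2.
[difficulty: provable-now] [Ginibre1970, arXiv:1803.01950]

TWO-LAYER PLAN. Foreseen glued splits once staffed (nothing filed now): CommutatorSkewMoment ⇐
stub_su2Rung (N = 2, S³ calculus) → stub_innerConjugationMoment
(∀ N ≥ 2 ∀ X: ∫ (|tr Y|²−1) Re tr(XYX⁻¹Y⁻¹) dY = (N² − |tr X|²)/(N(N²−1))) →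
stub_traceMomentCombination (N ≥ 3: ∫ (|tr X|²−1)(N²−|tr X|²) dX = −1)
— registered birth skeleton tpa/bc/CommutatorSkewMoment_birth.lean (rc 0, sorries = stubs = 3);
OneSiteCovDerivative ⇐ stub_tiltedCovHasDerivAt
(HasDerivAt … (−cubicCumulant N) 0: differentiation of the tilted product-Haar covariance) →
stub_cubicCumulant (cubicCumulant N = −(4/N²)·κ_N) —
skeleton tpa/bc/OneSiteCovDerivative_birth.lean (rc 0, sorries = stubs = 2).

KILL CRITERIA. Refutation of the SIGN in crux 2 (κ_N ≥ 0 for some N ≥ 2) closes the route outright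
(close --reason refuted:CommutatorSkewMoment) and
falsifies the barrier's witness (W1) (its (W2) measurement would remain); refutation of the exact
CONSTANT with the sign intact is class
misstated ⇒ repaired item CommutatorSkewMomentR with the corrected value, same glue; refutation of
crux 3's factor 4/N² likewise
misstated (any positive factor keeps the glue). A landing of `ToronPlaneAnticorrelation` by another
route (e.g. certified numerics for (W2))
moots this line (close --reason superseded).

NOT DECOMPOSED YET. The (2,2) Weingarten/Schur step inside stub_innerConjugationMoment (whether
provers go through the tree's entrywise quartic moments or
through the commutant of the conjugation representation on M_N(ℂ)), the measure-theoretic packaging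
of "differentiate a tilted
product-Haar expectation at β = 0" (Mathlib `hasDerivAt_integral_of_dominated_loc_of_deriv_le` vs
the tree's Gibbs-tilt lemmas), and
the SU(2) rung's S³ parametrisation are layer-2 choices left to the provers; constants are fixed
above.

CHEAPEST FALSIFIER. A ten-line Haar Monte-Carlo of κ_N (instrument row «mc_kappa(N, samples)»,
tpa/mc_kappa.py; the barrier's own kit j022105 is the N = 2
instance): prediction κ_N = −1/(N(N²−1)) = −0.1667, −0.04167, −0.01667, −0.00833 for N = 2, 3, 4, 5.
RUN by the seat before filing
(kit j306420, 10⁶ Haar pairs per N): all four signs negative, values on the predicted law (##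
Numbers) — the line survives its own falsifier. The exact N = 2 value −1/6 was also obtained by hand
from S³ moments
(E_b[(4b₀²−1)|a⃗×b⃗|²] = −|a⃗|²/6).

NUMBERS. κ_N = −1/(N(N²−1)); f′(0) = d/dβ Literature.Barriers.QuantumFields.complementaryPlaneCov N
1 β |₀ = 4κ_N/N² = −4/(N³(N²−1)) (N = 2: −1/6; N = 3: −1/54; N = 4: −1/240),
the coefficient printed in the barrier file's witness (W1)
[Literature.Barriers.QuantumFields.ToronPlaneAnticorrelation, kit j022105:
−0.1664(17) at N = 2]. Ingredient moments (tree): E|tr U|² = 1 (N ≥ 2), E|tr U|⁴ = 2 (N ≥ 2),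
E|U₀₀|⁴ = 2/(N(N+1)), E|U₀₀|²|U₁₁|² = 1/(N²−1),
E U₀₀U₁₁Ū₀₁Ū₁₀ = −1/((N−1)N(N+1)). Seat MC (tpa/mc_kappa.out): kit j306420 (10⁶ Haar pairs per N,
numpy QR sampler, 25 s): κ_MC = −0.1682(16) [pred −0.1667], −0.0404(17) [−0.0417], −0.0172(15)
[−0.0167], −0.0066(13) [−0.0083] for N = 2, 3, 4, 5 — sign and 1/(N(N²−1)) law confirmed within ≤
1.3σ.

DEFINITION REQUESTS. None: every object (suWilsonMeasure, complementaryPlaneCov,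
Literature.MathematicalPhysics.QuantumFieldTheory.haarProbability on Matrix.specialUnitaryGroup,
HasDerivAt) exists in the tree / Mathlib.

Novelty: Searches (2026-08-28): lit search --hybrid "Weingarten unitary group integration plaquette plaquette
correlation strong coupling expansion" (6 docs: [corpus:book:montvay1994-quantum-fields-lattice
p.148], [corpus:book:creutz2022-quarks-gluons-lattices pp.30–35, Ch. 8 Group integration — confirmed
lit read --grep], [corpus:book:oitmaa2006-series-expansion-methods p.195],
[corpus:book:makeenko2023-methods-contemporary-gauge-theory p.85], Meyer-Ortmanns–Reisz p.306, Rebbi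
p.380); lit search "Eguchi-Kawai one-site plaquette correlation" (local 2:
[corpus:paper:arxiv-hep-th_0101216 p.7], [corpus:paper:arxiv-hep-th_0003119 p.14]; remote 5:
[graph:doi:10.1016/0370-2693(82)90355-0] Seo–Ukawa 1982 off-axis plaquette–plaquette correlations,
[graph:doi:10.1088/0305-4616/11/9/008] Lewis 1985 EK Monte-Carlo, doi:10.1016/0370-2693(84)90471-4);
lit vsearch "<negative correlation of orthogonal plaquettes in SU(N) at strong coupling>" (6:
Montvay–Münster p.161, Creutz pp.44–78, [corpus:book:greensite2011-introduction-confinement-problem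
pp.13–22], Rebbi, Makeenko); lit galaxy search "Weingarten function|Eguchi-Kawai|plaquette-plaquette
correlation" --star all (16 rows; relevant [galaxy:panama:512716015927381] Makeenko,
[galaxy:panama:490322056446005] Deift–Forrester RMT volume; rest noise); lean search
complementaryPlaneCov / ToronPlaneAnticorrelation (only the barrier file + SZZPoincareApplications
import); ledger negatives --problem QuantumFields (9712, 9756 = the opposite, refuted positive  [refs: 10.1016/0370-2693(82, 10.1088/0305-4616/11/9/008, 10.1016/0370-2693(84, 10.1017/9781009290395, book:montvay1994-quantum-fields-lattice, book:creutz2022-quarks-gluons-lattices, book:oitmaa2006-series-expansion-methods, book:makeenko2023-methods-contemporary-gauge-theory, paper:arxiv-hep-th_0101216, paper:arxiv-hep-th_0003119, doi:10.1016/0370-2693, doi:10.1088/0305-4616/11/9/008, book:greensite2011]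

Barriers (technique_class: invariant-integration, haar-moments, cumulant-expansion): - technique_class: invariant-integration, haar-moments, cumulant-expansion
- Literature.Barriers.QuantumFields.ToronPlaneAnticorrelation: the line DISCHARGES this barrier's
named fact (it supplies the hypothesis h of `exists_not_forall_admits` via
`toronPlaneAnticorrelation_of_oneSite`); it lies OUTSIDE the barrier's technique class
(correlation-inequalities-by-local-criterion): it proves a negative correlation, it is not an
association engine.
- Literature.Barriers.QuantumFields.EguchiKawaiBreakdown: the one-site torus is the Eguchi–Kawai
model, but that barrier concerns large-N reduction at WEAK coupling (centre-symmetry breaking, N →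
∞); this line is at fixed finite N and β → 0⁺ (first cumulant) and makes no large-N or reduction
claim — outside its scope.
- Literature.Barriers.QuantumFields.MigdalKadanoffGroupBlindness: no renormalisation-group recursion
is used; does not apply.
- Literature.Barriers.QuantumFields.UVStabilityNonUniqueness: no continuum limit or scheme is
involved; does not apply.
- Negatives index: stmt-QuantumFields-9712 PlaquetteCovarianceNonneg and -9756
DualPositiveAssociation (refuted-substantive, measured (W2)); this line is their NEGATION side made
theorem-grade on the arena L = 1 (it cannot restate them); no other QuantumFields negative concerns
Haar moments.

sub-problem: YangMills · status: draft · opened planner-ym-idea-3-g7-0 2026-08-28T10:52:40Z · rev 0 · ledger route-QuantumFields-ToronCumulantSign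
GENERATED by the gate from the ledger (D-0016/17). Provers cite these decls: `theorem foo : Summit.QuantumFields.YangMills.Theses.ToronCumulantSign.<Decl> := …` in Summits/QuantumFields/YangMills/Theorems/<Name>.lean.
-/

namespace Summit.QuantumFields.YangMills.Theses.ToronCumulantSign

open scoped BigOperators Topology Manifold Classical MeasureTheory ProbabilityTheory Matrix InnerProductSpace ComplexConjugate ContinuousMap
open Filter Set Function TopologicalSpace MeasureTheory

attribute [summit_statement] _root_.YangMills

/-- item stmt-QuantumFields-27530 · crux · rank 2 · closed · proved by Summit.QuantumFields.YangMills.Theorems.ToronCumulantSign.commutatorSkewMoment_proof (prover) · by planner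
why it might fail: Only the constant can be wrong (a slip in α = 1/(N²−1), β′ = (N²−2)/((N−1)N(N+1)) or an SU(2)-specific invariant); the SIGN is checked at N = 2 by hand (S³ moments, −1/6), by the barrier's MC kit j022105 (−0.1664(17)) and at N = 2…5 by the seat's Haar MC kit j306420.
sources: CollinsSniady2006, doi:10.1017/9781009290395, Literature.Barriers.QuantumFields.ToronPlaneAnticorrelation
[crux] For every N ≥ 2, with dX, dY the Haar probability measures of SU(N): ∫∫ (|tr X|² − 1)(|tr Y|²
− 1) Re tr(X Y X⁻¹ Y⁻¹) dX dY = −1/(N(N²−1)) (N = 2: −1/6; N = 3: −1/24). [difficulty: M] -/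
@[route_item "route-QuantumFields-ToronCumulantSign", crux]
def CommutatorSkewMoment : Prop :=
  ∀ N : ℕ, 2 ≤ N → ∫ X, ∫ Y, (Complex.normSq (X : Matrix (Fin N) (Fin N) ℂ).trace - 1) * (Complex.normSq (Y : Matrix (Fin N) (Fin N) ℂ).trace - 1) * ((X * Y * X⁻¹ * Y⁻¹ : Matrix.specialUnitaryGroup (Fin N) ℂ) : Matrix (Fin N) (Fin N) ℂ).trace.re ∂Literature.MathematicalPhysics.QuantumFieldTheory.haarProbability (Matrix.specialUnitaryGroup (Fin N) ℂ) ∂Literature.MathematicalPhysics.QuantumFieldTheory.haarProbability (Matrix.specialUnitaryGroup (Fin N) ℂ) = -1 / ((N : ℝ) * ((N : ℝ) ^ 2 - 1))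

-- `CommutatorSkewMoment` holds: proved by `Summit.QuantumFields.YangMills.Theorems.ToronCumulantSign.commutatorSkewMoment_proof` (its module imports this route file, so no `_holds` link can be stated here).

/-- item stmt-QuantumFields-27531 · crux · rank 3 · closed · proved by Summit.QuantumFields.YangMills.Theorems.ToronCumulantSign.oneSiteCovDerivative_proof (prover) · by planner
why it might fail: Bookkeeping: the two in-plane terms must vanish exactly (independence at β = 0) and each of the four mixed planes must give κ_N/N²; an orientation slip in plaquetteHolonomy_oneSite would change the factor 4/N² (not the sign: Re tr of a commutator is orientation-blind).
sources: arXiv:1803.01950, Wilson1974, CollinsSniady2006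
[crux] For every N ≥ 2, on the one-site torus (ℤ/1)⁴ the complementary-plane covariance β ↦
Literature.Barriers.QuantumFields.complementaryPlaneCov N 1 β = Cov_{N,1,β}(Re tr U_(0;01), Re tr
U_(0;23)) is differentiable at β = 0 with derivative (4/N²)·κ_N, κ_N the commutator skew moment of
crux 2 (first β-cumulant of the Gibbs-tilted product Haar measure: the two in-plane plaquettes
contribute 0, the four mixed planes (02), (03), (12), (13) contribute κ_N/N² each after the inner
Schur integrations ∫ Re tr(g h g⁻¹ h⁻¹) dh = |tr g|²/N). [difficulty: L] -/
@[route_item "route-QuantumFields-ToronCumulantSign", crux]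
def OneSiteCovDerivative : Prop :=
  ∀ N : ℕ, 2 ≤ N → HasDerivAt (fun β : ℝ => Literature.Barriers.QuantumFields.complementaryPlaneCov N 1 β) (4 / (N : ℝ) ^ 2 * ∫ X, ∫ Y, (Complex.normSq (X : Matrix (Fin N) (Fin N) ℂ).trace - 1) * (Complex.normSq (Y : Matrix (Fin N) (Fin N) ℂ).trace - 1) * ((X * Y * X⁻¹ * Y⁻¹ : Matrix.specialUnitaryGroup (Fin N) ℂ) : Matrix (Fin N) (Fin N) ℂ).trace.re ∂Literature.MathematicalPhysics.QuantumFieldTheory.haarProbability (Matrix.specialUnitaryGroup (Fin N) ℂ) ∂Literature.MathematicalPhysics.QuantumFieldTheory.haarProbability (Matrix.specialUnitaryGroup (Fin N) ℂ)) 0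

-- `OneSiteCovDerivative` holds: proved by `Summit.QuantumFields.YangMills.Theorems.ToronCumulantSign.oneSiteCovDerivative_proof` (its module imports this route file, so no `_holds` link can be stated here).

/-- item stmt-QuantumFields-27532 · support · rank 9 · closed · proved by Summit.QuantumFields.YangMills.Theorems.ToronCumulantSign.oneSiteCovAtZero_proof (prover) · by planner
sources: Ginibre1970, arXiv:1803.01950
[support] At β = 0 the one-site Wilson measure is product Haar on the four links and the two
plaquette energies Re tr U_(0;01) (links 0, 1) and Re tr U_(0;23) (links 2, 3) are independent, so
Literature.Barriers.QuantumFields.complementaryPlaneCov N 1 0 = 0 for every N ≥ 2. [difficulty: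
provable-now] -/
@[route_item "route-QuantumFields-ToronCumulantSign", crux]
def OneSiteCovAtZero : Prop :=
  ∀ N : ℕ, 2 ≤ N → Literature.Barriers.QuantumFields.complementaryPlaneCov N 1 0 = 0

-- `OneSiteCovAtZero` holds: proved by `Summit.QuantumFields.YangMills.Theorems.ToronCumulantSign.oneSiteCovAtZero_proof` (its module imports this route file, so no `_holds` link can be stated here).

/-- item stmt-QuantumFields-27533 · assembly · rank 1 · closed · proved by Summit.QuantumFields.YangMills.Theorems.ToronCumulantSign.assembly_proof (prover) · by planner
sources: Literature.Barriers.QuantumFields.ToronPlaneAnticorrelation, CollinsSniady2006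
[assembly] CommutatorSkewMoment → OneSiteCovDerivative → OneSiteCovAtZero →
ToronPlaneAnticorrelation (the barrier-ledger named fact; via toronPlaneAnticorrelation_of_oneSite
and one line of real analysis). -/
@[route_item "route-QuantumFields-ToronCumulantSign"]
def Assembly : Prop :=
  CommutatorSkewMoment → OneSiteCovDerivative → OneSiteCovAtZero → Literature.Barriers.QuantumFields.ToronPlaneAnticorrelation

-- `Assembly` holds: proved by `Summit.QuantumFields.YangMills.Theorems.ToronCumulantSign.assembly_proof` (its module imports this route file, so no `_holds` link can be stated here).

/-! D-0027 §2.1 — DECIDING THEOREM (planner-authored via `route open/edit --closes-file`; by planner-ym-idea-3-g7-0 2026-08-28T10:52:40Z):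
its hypotheses are this route's items and its conclusion the sub-problem Statement (glue_lint), and it elaborates with this file. -/

@[closes "route-QuantumFields-ToronCumulantSign"] theorem closes (h₁ : Summit.QuantumFields.YangMills.Theses.ToronCumulantSign.CommutatorSkewMoment) (h₂ : Summit.QuantumFields.YangMills.Theses.ToronCumulantSign.OneSiteCovDerivative)
    (h₀ : Summit.QuantumFields.YangMills.Theses.ToronCumulantSign.OneSiteCovAtZero) :
    Literature.Barriers.QuantumFields.ToronPlaneAnticorrelation := by
  refine Literature.Barriers.QuantumFields.toronPlaneAnticorrelation_of_oneSite (fun N hN => ?_)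
  have hd := h₂ N hN
  rw [h₁ N hN] at hd
  have hN' : (2 : ℝ) ≤ N := by exact_mod_cast hN
  have hpos : (0 : ℝ) < (N : ℝ) * ((N : ℝ) ^ 2 - 1) := by nlinarith
  have hc : 4 / (N : ℝ) ^ 2 * (-1 / ((N : ℝ) * ((N : ℝ) ^ 2 - 1))) < 0 :=
    mul_neg_of_pos_of_neg (by positivity) (div_neg_of_neg_of_pos (by norm_num) hpos)
  -- real analysis: f 0 = 0, HasDerivAt f c 0, c < 0 ⇒ ∃ β > 0, f β < 0
  have ht := hd.tendsto_slope_zero_right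
  have hev : ∀ᶠ t in nhdsWithin (0 : ℝ) (Set.Ioi 0),
      t⁻¹ • (Literature.Barriers.QuantumFields.complementaryPlaneCov N 1 (0 + t) -
        Literature.Barriers.QuantumFields.complementaryPlaneCov N 1 0) < 0 :=
    ht.eventually (Iio_mem_nhds hc)
  have hself : ∀ᶠ t in nhdsWithin (0 : ℝ) (Set.Ioi 0), t ∈ Set.Ioi (0 : ℝ) := self_mem_nhdsWithin
  obtain ⟨t, hlt, ht0⟩ := (hev.and hself).exists
  refine ⟨t, ht0, ?_⟩
  rw [zero_add, h₀ N hN, sub_zero, smul_eq_mul] at hlt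
  have hti : 0 < t⁻¹ := inv_pos.mpr ht0
  by_contra hft
  exact absurd hlt (not_lt.mpr (mul_nonneg hti.le (not_lt.mp hft)))

end Summit.QuantumFields.YangMills.Theses.ToronCumulantSign
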